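import Summits.CriticalPhenomena.PercolationContinuityZ3.Theorems.SahiMasterFamilyFCombFaceShiftDet
import Summits.CriticalPhenomena.PercolationContinuityZ3.Theorems.SahiMasterFamilyFCombShiftSigma

/-!
# LEMMA J** (canonical form): the face routing of the one-shared-coordinate programme

Support file (prover seat `prim-bnk-2`, gen 31; `--supports stmt-CriticalPhenomena-4575`).  Memo:
`run/shared/lean/prim/prim-l12/FROM-prim-bnk-2-g31-COMPRESSION-THEOREM.md` §2bis.  Companion of THEOREM R***
(`SahiFComb.Shift.isUnit_det_faceIncl`, file `…SahiMasterFamilyFCombFaceShiftDet`).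

Fix a duplicate-free coordinate list `l` (ground set `J = l.toFinset`) and ANY family `Δ` of finsets (in the application
`Δ = C¹ \ C⁰` for up-sets `C⁰ ⊆ C¹` of `2^J`).  For `w ⊆ J` let `Δ_w = {s ∈ Δ | Disjoint s w}` and `A_w = D_l Δ_w`, the iterated
down-compression (`A_w = σ T_w` inside the cube `J \ w`, where `T_w = U_l Δ_w` is the canonical LEMMA-I** up-set of g31, file
`…TwoLevelKleitmanHall`).  A *leaver* of LEMMA J** is a partition `(x, y, z)` of `J` with `z ∈ T_x`, i.e. `y ∈ A_x`; we encode it as the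
face `(w, t) = (x, z)` (so `y = J \ (w ∪ t)`), and the leaver family is
`𝓟 = {(w,t) : w, t ⊆ J disjoint, J \ (w ∪ t) ∈ A_w}`.

* `downs_memberSubfamily_subset`, `downs_nonMemberSubfamily_subset`: for `c ∈ l`,
  `(D_l 𝒳)¹ ⊆ D_l (𝒳⁰) ⊆ (D_l 𝒳)⁰` (sections along `c`) — the monotonicity behind the up-set property of `𝓟`;
* `isUnit_det_faceIncl_leavers`: `𝓟` is closed under the moves `0 → 1`, `1 → 2` of THEOREM R***, hence `det (faceIncl l 𝓟 𝓟) = ±1`;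
* **`exists_face_routing` (LEMMA J**).**  There is a bijection `ρ : 𝓟 ≃ 𝓟` with `w ⊆ (ρ f).t` and `J \ (w ∪ t) ⊆ (ρ f).w` for every
  face `f = (w,t) ∈ 𝓟`.  Reading `ρ f = (w', t')` as the slot `(x', y', z') = (t', w', J \ (w' ∪ t'))` this says `x ⊆ x'`, `y ⊆ y'`
  and `x' ∈ T_{y'}` — a bijective routing of the leavers onto the slots `{(x',y',z') : x' ∈ T_{y'}}` (kind 1 if `x' ∈ Δ`, kind 2
  if `x' ∈ C⁰`), which is LEMMA J** of `PROBLEMS-g30-TWO-LEVEL-KLEITMAN-LEMMAS.md` with the canonical up-sets.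

No new definitions; no `sorry`; standard axioms.
-/

namespace Summit.CriticalPhenomena.PercolationContinuityZ3.Theorems

namespace SahiFComb.Shift

open Finset FinsetFamily Matrix

variable {α : Type*} [DecidableEq α]

/-! ### 1. The section chain of an iterated down-compression -/

/-- Down-compression along `c` does nothing to a family of `c`-free sets. [folklore] -/
theorem compression_eq_self_of_forall_notMem {c : α} {𝒜 : Finset (Finset α)} (h : ∀ s ∈ 𝒜, c ∉ s) :
    𝓓 c 𝒜 = 𝒜 := by
  ext s
  rw [Down.mem_compression]
  constructor
  · rintro (⟨hs, -⟩ | ⟨-, hs⟩)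
    · exact hs
    · exact absurd (mem_insert_self c s) (h _ hs)
  · intro hs
    exact Or.inl ⟨hs, by rwa [erase_eq_of_notMem (h s hs)]⟩

/-- The section chain of an iterated down-compression through a coordinate `c ∈ l`:
`(D_l 𝒳)¹ ⊆ D_l (𝒳⁰) ⊆ (D_l 𝒳)⁰`, where `⁰, ¹` are the `c`-free part and the `c`-part (with `c` erased).  (Compressions along
`i ≠ c` act on the two sections separately, the `c`-step replaces `(𝒴⁰ | 𝒴¹)` by `(𝒴⁰ ∪ 𝒴¹ | 𝒴⁰ ∩ 𝒴¹)`, and `D` is monotone,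
`downs_mono` of file `…ShiftSigma`.)
[this work] -/
theorem downs_section_chain {c : α} :
    ∀ (l : List α), l.Nodup → c ∈ l → ∀ 𝒳 : Finset (Finset α),
      (l.foldl (fun 𝒴 i => 𝓓 i 𝒴) 𝒳).memberSubfamily c ⊆ l.foldl (fun 𝒴 i => 𝓓 i 𝒴) (𝒳.nonMemberSubfamily c) ∧
      l.foldl (fun 𝒴 i => 𝓓 i 𝒴) (𝒳.nonMemberSubfamily c) ⊆ (l.foldl (fun 𝒴 i => 𝓓 i 𝒴) 𝒳).nonMemberSubfamily c
  | [], _, h, _ => absurd h List.not_mem_nil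
  | i :: l, hl, hc, 𝒳 => by
    obtain ⟨hil, hl'⟩ := List.nodup_cons.1 hl
    rw [List.foldl_cons, List.foldl_cons]
    by_cases hic : i = c
    · subst hic
      rw [memberSubfamily_downs l hil, nonMemberSubfamily_downs l hil, memberSubfamily_compression_self,
        nonMemberSubfamily_compression_self,
        compression_eq_self_of_forall_notMem (fun s hs => (mem_nonMemberSubfamily.1 hs).2)]
      exact ⟨downs_mono l inter_subset_left, downs_mono l subset_union_left⟩
    · have hc' : c ∈ l := (List.mem_cons.1 hc).resolve_left (Ne.symm hic)
      have key := downs_section_chain l hl' hc' (𝓓 i 𝒳)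
      rwa [nonMemberSubfamily_compression hic] at key

/-- First half of the section chain in membership form: `insert c s ∈ D_l 𝒳`, `c ∉ s` ⟹ `s ∈ D_l (𝒳⁰)`. [this work] -/
theorem mem_downs_nonMemberSubfamily_of_insert_mem {c : α} {l : List α} (hl : l.Nodup) (hc : c ∈ l)
    {𝒳 : Finset (Finset α)} {s : Finset α} (hs : insert c s ∈ l.foldl (fun 𝒴 i => 𝓓 i 𝒴) 𝒳) (hcs : c ∉ s) :
    s ∈ l.foldl (fun 𝒴 i => 𝓓 i 𝒴) (𝒳.nonMemberSubfamily c) :=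
  (downs_section_chain l hl hc 𝒳).1 (mem_memberSubfamily.2 ⟨hs, hcs⟩)

/-- Second half of the section chain in membership form: `s ∈ D_l (𝒳⁰)` ⟹ `s ∈ D_l 𝒳` and `c ∉ s`. [this work] -/
theorem mem_downs_of_mem_downs_nonMemberSubfamily {c : α} {l : List α} (hl : l.Nodup) (hc : c ∈ l)
    {𝒳 : Finset (Finset α)} {s : Finset α} (hs : s ∈ l.foldl (fun 𝒴 i => 𝓓 i 𝒴) (𝒳.nonMemberSubfamily c)) :
    s ∈ l.foldl (fun 𝒴 i => 𝓓 i 𝒴) 𝒳 ∧ c ∉ s :=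
  mem_nonMemberSubfamily.1 ((downs_section_chain l hl hc 𝒳).2 hs)

/-! ### 2. The leaver family is an up-set of `{0<1<2}^J` -/

/-- The restricted families `Δ_w = {s ∈ Δ | Disjoint s w}` are sectioned by enlarging `w`:
`Δ_{insert c w} = (Δ_w)⁰`. [this work] -/
theorem filter_disjoint_insert (Δ : Finset (Finset α)) (w : Finset α) (c : α) :
    {s ∈ Δ | Disjoint s (insert c w)} = ({s ∈ Δ | Disjoint s w} : Finset (Finset α)).nonMemberSubfamily c := by
  ext s
  simp only [mem_filter, mem_nonMemberSubfamily, disjoint_insert_right]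
  tauto

/-- **The leaver family is an up-set of the face lattice, hence its face-domination kernel is unimodular.**  With
`A_w = D_l {s ∈ Δ | Disjoint s w}` and `𝓟 = {(w,t) : w,t ⊆ J, w ∩ t = ∅, J \ (w ∪ t) ∈ A_w}` (`J = l.toFinset`), the family `𝓟`
is closed under `(w,t) ↦ (insert a w, t)` (`a ∈ J` free) and `(w,t) ↦ (w.erase a, insert a t)` (`a ∈ w`), so THEOREM R*** applies:
`IsUnit (faceIncl l 𝓟 𝓟).det`. [this work] -/
theorem isUnit_det_faceIncl_leavers (l : List α) (hl : l.Nodup) (Δ : Finset (Finset α))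
    (A : Finset α → Finset (Finset α)) (hA : ∀ w, A w = l.foldl (fun 𝒴 i => 𝓓 i 𝒴) {s ∈ Δ | Disjoint s w})
    (𝓟 : Finset (Finset α × Finset α))
    (h𝓟 : 𝓟 = {p ∈ l.toFinset.powerset ×ˢ l.toFinset.powerset |
        Disjoint p.1 p.2 ∧ l.toFinset \ (p.1 ∪ p.2) ∈ A p.1}) :
    IsUnit (faceIncl l 𝓟 𝓟).det := by
  have mem𝓟 : ∀ p : Finset α × Finset α, p ∈ 𝓟 ↔
      p.1 ⊆ l.toFinset ∧ p.2 ⊆ l.toFinset ∧ Disjoint p.1 p.2 ∧ l.toFinset \ (p.1 ∪ p.2) ∈ A p.1 := by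
    intro p
    rw [h𝓟, mem_filter, mem_product, mem_powerset, mem_powerset, and_assoc]
  refine isUnit_det_faceIncl l hl 𝓟 (fun p hp => ((mem𝓟 p).1 hp).2.2.1) (fun p hp a ha => ?_)
    (fun p hp a ha ha1 ha2 => ?_) (fun p hp a ha => ?_)
  · -- faces are supported on `l`
    obtain ⟨h1, h2, -, -⟩ := (mem𝓟 p).1 hp
    rcases ha with ha | ha
    · exact List.mem_toFinset.1 (h1 ha)
    · exact List.mem_toFinset.1 (h2 ha)
  · -- the move `0 → 1`: `(w,t) ↦ (insert a w, t)`
    obtain ⟨h1, h2, hd, hy⟩ := (mem𝓟 p).1 hp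
    have haJ : a ∈ l.toFinset := List.mem_toFinset.2 ha
    refine (mem𝓟 _).2 ⟨insert_subset haJ h1, h2, disjoint_insert_left.2 ⟨ha2, hd⟩, ?_⟩
    have hay : a ∈ l.toFinset \ (p.1 ∪ p.2) := mem_sdiff.2 ⟨haJ, by simp [ha1, ha2]⟩
    have e : l.toFinset \ (insert a p.1 ∪ p.2) = (l.toFinset \ (p.1 ∪ p.2)).erase a := by
      ext b
      simp only [mem_sdiff, mem_union, mem_insert, mem_erase]
      tauto
    rw [e, hA, filter_disjoint_insert]
    refine mem_downs_nonMemberSubfamily_of_insert_mem hl ha ?_ (notMem_erase a _)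
    rw [insert_erase hay, ← hA]
    exact hy
  · -- the move `1 → 2`: `(w,t) ↦ (w.erase a, insert a t)`
    obtain ⟨h1, h2, hd, hy⟩ := (mem𝓟 p).1 hp
    have haJ : a ∈ l.toFinset := h1 ha
    have hal : a ∈ l := List.mem_toFinset.1 haJ
    have ha2 : a ∉ p.2 := disjoint_left.1 hd ha
    refine (mem𝓟 _).2 ⟨(erase_subset a p.1).trans h1, insert_subset haJ h2, ?_, ?_⟩
    · exact disjoint_insert_right.2 ⟨notMem_erase a p.1, (disjoint_of_subset_left (erase_subset a p.1) hd)⟩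
    · have e : l.toFinset \ (p.1.erase a ∪ insert a p.2) = l.toFinset \ (p.1 ∪ p.2) := by
        ext b
        simp only [mem_sdiff, mem_union, mem_insert, mem_erase]
        constructor
        · rintro ⟨hb, hn⟩
          refine ⟨hb, ?_⟩
          rintro (hb1 | hb2)
          · by_cases hba : b = a
            · exact hn (Or.inr (Or.inl hba))
            · exact hn (Or.inl ⟨hba, hb1⟩)
          · exact hn (Or.inr (Or.inr hb2))
        · rintro ⟨hb, hn⟩
          refine ⟨hb, ?_⟩
          rintro (⟨-, hb1⟩ | rfl | hb2)
          · exact hn (Or.inl hb1)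
          · exact hn (Or.inl ha)
          · exact hn (Or.inr hb2)
      rw [e, hA]
      have hy' : l.toFinset \ (p.1 ∪ p.2) ∈ l.foldl (fun 𝒴 i => 𝓓 i 𝒴) {s ∈ Δ | Disjoint s (insert a (p.1.erase a))} := by
        rw [insert_erase ha, ← hA]; exact hy
      rw [filter_disjoint_insert] at hy'
      exact (mem_downs_of_mem_downs_nonMemberSubfamily hl hal hy').1

/-! ### 3. LEMMA J**: the routing -/

/-- **LEMMA J** (canonical form; prim-bnk-2 g31, memo §2bis).**  Let `l` be a duplicate-free coordinate list, `J = l.toFinset`,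
`Δ` any family of finsets, `A_w = D_l {s ∈ Δ | Disjoint s w}` (iterated down-compression) and
`𝓟 = {(w,t) : w, t ⊆ J, w ∩ t = ∅, J \ (w ∪ t) ∈ A_w}` the leaver family (leaver `(x,y,z) = (w, J \ (w ∪ t), t)`; the condition
says `z ∈ T_x := σ_{J\x} A_x = U_l (Δ ∩ 2^{J \ x})`, the canonical LEMMA-I** up-set).  Then there is a bijection `ρ : 𝓟 ≃ 𝓟` with
`w ⊆ (ρ f).2` and `J \ (w ∪ t) ⊆ (ρ f).1` for every `f = (w,t) ∈ 𝓟`: reading `ρ f = (w',t')` as the slot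
`(x',y',z') = (t', w', J \ (w' ∪ t'))` (so `x' ∈ T_{y'}`), every leaver is routed to a slot with `x ⊆ x'`, `y ⊆ y'`, bijectively.
Proof: a non-zero Leibniz term of the unimodular kernel `faceIncl l 𝓟 𝓟` (`isUnit_det_faceIncl_leavers`). [this work] -/
theorem exists_face_routing (l : List α) (hl : l.Nodup) (Δ : Finset (Finset α))
    (A : Finset α → Finset (Finset α)) (hA : ∀ w, A w = l.foldl (fun 𝒴 i => 𝓓 i 𝒴) {s ∈ Δ | Disjoint s w})
    (𝓟 : Finset (Finset α × Finset α))
    (h𝓟 : 𝓟 = {p ∈ l.toFinset.powerset ×ˢ l.toFinset.powerset |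
        Disjoint p.1 p.2 ∧ l.toFinset \ (p.1 ∪ p.2) ∈ A p.1}) :
    ∃ ρ : ↥𝓟 ≃ ↥𝓟, ∀ f : ↥𝓟,
      (f : Finset α × Finset α).1 ⊆ ((ρ f : ↥𝓟) : Finset α × Finset α).2 ∧
        l.toFinset \ ((f : Finset α × Finset α).1 ∪ (f : Finset α × Finset α).2) ⊆
          ((ρ f : ↥𝓟) : Finset α × Finset α).1 := by
  have hunit := isUnit_det_faceIncl_leavers l hl Δ A hA 𝓟 h𝓟
  -- Leibniz: a nonzero permutation term is a perfect matching of the domination relation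
  have hne : (faceIncl l 𝓟 𝓟).det ≠ 0 := hunit.ne_zero
  rw [Matrix.det_apply'] at hne
  obtain ⟨σ, -, hσ⟩ := Finset.exists_ne_zero_of_sum_ne_zero hne
  have hσ' : ∀ g : ↥𝓟, faceIncl l 𝓟 𝓟 (σ g) g ≠ 0 := fun g =>
    (Finset.prod_ne_zero_iff.1 (mul_ne_zero_iff.1 hσ).2) g (Finset.mem_univ _)
  refine ⟨σ.symm, fun f => ?_⟩
  have hf := hσ' (σ.symm f)
  rw [Equiv.apply_symm_apply, faceIncl_apply] at hf
  simp only [ne_eq, ite_eq_right_iff, one_ne_zero, imp_false, not_not] at hf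
  refine ⟨hf.1, fun a ha => ?_⟩
  rw [mem_sdiff, mem_union, not_or] at ha
  exact hf.2 a (List.mem_toFinset.1 ha.1) ha.2.1 ha.2.2

end SahiFComb.Shift

end Summit.CriticalPhenomena.PercolationContinuityZ3.Theorems
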